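import Summits.CriticalPhenomena.PercolationContinuityZ3.Theses.PercEventualDensity
import Literature.Probability.Percolation.SharpnessDCTProofs

/-!
# Crux attack on `PercEventualDensity.SomeScaleDensity` (stmt-CriticalPhenomena-17919)

Refuter probes (crux-attack at birth):
* `someScaleDensity_iff` — the decl unfolds (`Iff.rfl`) to the hand-written reading
  `∀ p, 0 < θ(p) → SDVConclusion p`.
* `thetaPos_satisfiable` — the hypothesis `0 < θ(p)` is satisfiable (`p = 1`, `θ(1) = 1`): not vacuous.
* `inBall_empty_subset` / `sdvConclusion_false_at_zero` — at `p = 0` (`P_0 = δ_∅`) the in-ball cluster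
  is `{0}` at every scale, so the conclusion FAILS for every `t > 0`: the hypothesis `0 < θ(p)` is
  load-bearing (`someScaleDensity_false_without_thetaPos : ¬ ∀ p, SDVConclusion p`).
-/

noncomputable section

open MeasureTheory ProbabilityTheory Filter Topology
open Literature.Probability.Percolation Literature.Probability.LatticeModels

namespace Summit.CriticalPhenomena.PercolationContinuityZ3.Theorems.SomeScaleDensity.Negative

/-- The in-ball cluster `C^m(0) = {v ∈ B_m : 0 ↔ v inside B_m}` of the route file. [folklore] -/
def inBall (ω : BondConfig (Site 3)) (m : ℕ) : Set (Site 3) :=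
  {v | v ∈ box 3 m ∧ ω ∈ openConnIn (↑(box 3 m)) 0 v}

/-- The conclusion of `SomeScaleDensity` at the parameter `p`. [folklore] -/
def SDVConclusion (p : unitInterval) : Prop :=
  ∃ t : ℝ, 0 < t ∧ 0 < (bondPercolation (zdGraph 3) p).real
    {ω | ∃ᶠ m : ℕ in Filter.atTop, t * ((box 3 m).card : ℝ) ≤ ((inBall ω m).ncard : ℝ)}

/-- The route decl is literally `∀ p, 0 < θ(p) → SDVConclusion p`. [folklore] -/
theorem someScaleDensity_iff :
    Summit.CriticalPhenomena.PercolationContinuityZ3.Theses.PercEventualDensity.SomeScaleDensity ↔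
      ∀ p : unitInterval, 0 < theta (zdGraph 3) 0 p → SDVConclusion p :=
  Iff.rfl

/-- Non-vacuity: the hypothesis `0 < θ(p)` holds at `p = 1`. [folklore] -/
theorem thetaPos_satisfiable : ∃ p : unitInterval, 0 < theta (zdGraph 3) 0 p :=
  ⟨1, by rw [DCT16.theta_one (d := 3) (by norm_num)]; exact one_pos⟩

/-- In the empty configuration the in-ball cluster of the origin is `{0}` (as a subset). [folklore] -/
theorem inBall_empty_subset (m : ℕ) : inBall (∅ : BondConfig (Site 3)) m ⊆ {0} := by
  intro v hv
  obtain ⟨-, hx, hy, hreach⟩ := hv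
  have hbot : (openGraph (∅ : BondConfig (Site 3))).induce (↑(box 3 m) : Set (Site 3)) = ⊥ := by
    ext a b
    simp [openGraph_adj]
  rw [hbot, SimpleGraph.reachable_bot] at hreach
  have := congrArg Subtype.val hreach
  simpa using this.symm

/-- Hence `|C^m(0)| ≤ 1` in the empty configuration. [folklore] -/
theorem ncard_inBall_empty_le (m : ℕ) : (inBall (∅ : BondConfig (Site 3)) m).ncard ≤ 1 := by
  calc (inBall (∅ : BondConfig (Site 3)) m).ncard ≤ ({0} : Set (Site 3)).ncard :=
        Set.ncard_le_ncard (inBall_empty_subset m) (Set.finite_singleton 0)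
    _ = 1 := Set.ncard_singleton 0

/-- **The conclusion of `SomeScaleDensity` is FALSE at `p = 0`**: `P_0 = δ_∅` and `|C^m(0)| = 1 < t |B_m|`
for all large `m`. [folklore] -/
theorem sdvConclusion_false_at_zero : ¬ SDVConclusion 0 := by
  rintro ⟨t, ht, hpos⟩
  have hμ : bondPercolation (zdGraph 3) 0 = Measure.dirac (∅ : BondConfig (Site 3)) := by
    rw [bondPercolation]; exact setBernoulli_zero _
  have hnot : (∅ : BondConfig (Site 3)) ∉
      {ω : BondConfig (Site 3) | ∃ᶠ m : ℕ in Filter.atTop,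
        t * ((box 3 m).card : ℝ) ≤ ((inBall ω m).ncard : ℝ)} := by
    simp only [Set.mem_setOf_eq, Filter.not_frequently, not_le]
    refine Filter.eventually_atTop.2 ⟨⌈1 / t⌉₊ + 1, fun m hm => ?_⟩
    have hn : ((inBall (∅ : BondConfig (Site 3)) m).ncard : ℝ) ≤ 1 := by
      exact_mod_cast ncard_inBall_empty_le m
    have hm' : (1 / t : ℝ) < m := by
      have h1 : (1 / t : ℝ) ≤ ⌈1 / t⌉₊ := Nat.le_ceil _
      have h2 : ((⌈1 / t⌉₊ + 1 : ℕ) : ℝ) ≤ m := by exact_mod_cast hm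
      push_cast at h2
      linarith
    have htm : 1 < t * m := by
      rw [div_lt_iff₀ ht] at hm'
      linarith [mul_comm (m : ℝ) t]
    have h3 : (m : ℝ) ≤ ((box 3 m).card : ℝ) := by
      rw [card_box]
      have : m ≤ (2 * m + 1) ^ 3 :=
        le_trans (by omega) (Nat.le_self_pow (by norm_num) (2 * m + 1))
      exact_mod_cast this
    calc ((inBall (∅ : BondConfig (Site 3)) m).ncard : ℝ) ≤ 1 := hn
      _ < t * m := htm
      _ ≤ t * ((box 3 m).card : ℝ) := mul_le_mul_of_nonneg_left h3 ht.le
  rw [hμ, measureReal_def, Measure.dirac_apply, Set.indicator_of_notMem hnot,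
    ENNReal.toReal_zero] at hpos
  exact lt_irrefl _ hpos

/-- **Any proof of `SomeScaleDensity` must use `0 < θ(p)`**: with that hypothesis dropped
(`∀ p, SDVConclusion p`) the statement fails at `p = 0`. [folklore] -/
theorem someScaleDensity_false_without_thetaPos : ¬ ∀ p : unitInterval, SDVConclusion p :=
  fun h => sdvConclusion_false_at_zero (h 0)

end Summit.CriticalPhenomena.PercolationContinuityZ3.Theorems.SomeScaleDensity.Negative
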